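import Mathlib
import Summits.ValiantsHypothesis.ValiantsHypothesis.Theorems.GrenetZeonPolySizeQPAlgebraDimFour
import HarnessLib

/-!
# Crux `GrenetZeon.PolySizeQPAlgebra` (stmt-ValiantsHypothesis-8064), line `vbp-slice-dealg` —
# input (B) for every SHALLOW local type, and the rung `(n, ≤ s)` ⟸ (A) + (B) for DEEP types only

Input (B) of the `c = 1` box (`…LocalReduction`, `…LocalReductionDim`) — the type-independent local Hessian
bound `rank Hess λ(det A)(p) ≤ 2·dim R·n` at points with `det A(p) = 0` in the local Frobenius piece `R` — is a
theorem of the tree for the following SHALLOW types, uniformly in `n ≥ 10`: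

* curvilinear types (`rank_hess0_transl_le_of_basis_pow`, any `n`);
* square-zero types (`rank_hess0_transl_le_of_sqZero_algebra_of_two_le_finrank`, any `n`);
* types with `(ker φ)³ = 0` (`rank_hess0_transl_le_of_cube_zero'`; with `dim R/𝔪² ≤ dim R` the threshold
  `6n + 9·dim R + 2 ≤ 2·dim R·n + 18` holds for all `dim R ≥ 4`, `n ≥ 10`);
* every type of dimension `≤ 4` (`localHessianBound_of_finrank_le_four`, `n ≥ 6`).

This file records that (`localHessianBound_of_shallow`) and the resulting socket: call a local Frobenius
piece DEEP if `dim R ≥ 5`, it has no power basis `(1, e, …, e^{r-1})`, and `(ker φ)³ ≠ 0` (so `𝔪² ≠ 0` and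
the nilpotency index is `≥ 4`: Hilbert functions `(1,2,1,1)`, `(1,2,2,1)`, …).  Then

* `not_hasAlgDetRepr_perPoly_self_of_deepBound` — `¬ HasAlgDetRepr per_n n s` (`n ≥ 10`) from a good
  `c`-space (`s < c`, threshold `≥ 2sn`) and input (B) for the DEEP pieces of dimension `≤ s` only;
* `corner_all_large_of_deepBound_eventually` — the all-large-`n` column form.

For `s ≤ 4` there are no deep pieces (this is `…DimFour`); for `s = 5` a deep piece has Hilbert function
`(1,2,1,1)` (e.g. `ℂ[x,y]/(xy, y² - x³)`), and its residual-corank-`3` count (`AL(3)` of the hand memos) is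
what separates the rung `(n, ≤ 5)` from input (A) (a good `6`-space with threshold `10n`).
HONEST FRAMING: bookkeeping of conditional reductions; no stub of the line is closed; VP ≠ VNP is not moved.

References: T. Mignon, N. Ressayre, IMRN 2004:79, §2 [MignonRessayre2004].
-/

noncomputable section

open MvPolynomial Matrix
open Literature.Computability.AlgebraicComplexity

-- single-conjunct layout `Summits/ValiantsHypothesis/ValiantsHypothesis`: duplicated namespace by design
set_option linter.dupNamespace false

namespace Summit.ValiantsHypothesis.ValiantsHypothesis.Theorems.GrenetZeonPolySizeQPAlgebra

/-! ### Input (B) for shallow types, uniform threshold `n ≥ 10` -/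

section Shallow

variable {σ : Type*} [Fintype σ] [DecidableEq σ] {R : Type*} [CommRing R] [Algebra ℂ R]
  [Module.Finite ℂ R]

/-- **`LocalHessianBound` for every SHALLOW local Frobenius piece, `n ≥ 10`.**  If `R` (character `φ` with
nilpotent kernel, nondegenerate `λ`) has dimension `≤ 4`, or a power basis `(1, e, …, e^{r-1})` with `e^r = 0`,
or a square-zero kernel, or `(ker φ)³ = 0`, then for every affine `n × n` matrix `A` over `R[x_σ]` with
`F = λ(det A)` coefficientwise and every point `p` with `det A(p) = 0` in `R`:
`rank Hess F(p) ≤ 2 · dim_ℂ R · n`. [cite: MignonRessayre2004, §2] -/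
theorem localHessianBound_of_shallow {n : ℕ} (hn : 10 ≤ n) (φ : R →ₐ[ℂ] ℂ) {ν : ℕ}
    (hker : RingHom.ker (φ : R →+* ℂ) ^ ν = ⊥) (l : R →ₗ[ℂ] ℂ)
    (hl : ∀ r : R, (∀ x, l (x * r) = 0) → r = 0)
    (hshape : Module.finrank ℂ R ≤ 4 ∨
      (∃ (r : ℕ) (e : R), e ^ r = 0 ∧ ∃ b : Module.Basis (Fin r) ℂ R, ∀ j, b j = e ^ (j : ℕ)) ∨
      (∀ a b : R, φ a = 0 → φ b = 0 → a * b = 0) ∨ RingHom.ker (φ : R →+* ℂ) ^ 3 = ⊥)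
    (A : Matrix (Fin n) (Fin n) (MvPolynomial σ R)) (F : MvPolynomial σ ℂ)
    (hA : ∀ a b, (A a b).totalDegree ≤ 1) (hF : ∀ d, l (coeff d A.det) = coeff d F)
    (p : σ → ℂ) (hp : eval (fun i => algebraMap ℂ R (p i)) A.det = 0) :
    (hess0 (transl p F)).rank ≤ 2 * Module.finrank ℂ R * n := by
  classical
  by_cases h4 : Module.finrank ℂ R ≤ 4
  · exact localHessianBound_of_finrank_le_four (by omega) h4 φ hker l hl A F hA hF p hp
  rcases hshape with h | ⟨r, e, he, b, hb⟩ | hsq | hk3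
  · exact absurd h h4
  · exact rank_hess0_transl_le_of_basis_pow e he b hb l A F hA hF p hp
  · exact rank_hess0_transl_le_of_sqZero_algebra_of_two_le_finrank φ hsq (by omega) l A F hA hF p hp
  · refine rank_hess0_transl_le_of_cube_zero' φ hk3 (by omega) ?_ l A F hA hF p hp
    -- `6n + 9·(dim R - dim 𝔪²) + 2 ≤ 2·dim R·n + 18` for `dim R ≥ 5`, `n ≥ 10`
    set d := Module.finrank ℂ R with hd
    set d₂ := Module.finrank ℂ ((RingHom.ker (φ : R →+* ℂ) ^ 2).restrictScalars ℂ) with hd₂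
    obtain ⟨a, ha⟩ : ∃ a, d = 5 + a := ⟨d - 5, by omega⟩
    obtain ⟨b', hb'⟩ : ∃ b', n = 10 + b' := ⟨n - 10, by omega⟩
    have hsub : d - d₂ ≤ d := Nat.sub_le _ _
    have key : 6 * n + 9 * d + 2 ≤ 2 * d * n + 18 := by
      rw [ha, hb']; nlinarith [Nat.zero_le (a * b')]
    calc 6 * n + 9 * (d - d₂) + 2 ≤ 6 * n + 9 * d + 2 := by omega
      _ ≤ 2 * d * n + 18 := key

/-- The same for matrices of LINEAR forms (the shape inlined in `…LocalReduction` / `…LocalReductionDim`).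
[cite: MignonRessayre2004, §2] -/
theorem localHessianBound_of_shallow_of_isHomogeneous {n : ℕ} (hn : 10 ≤ n) (φ : R →ₐ[ℂ] ℂ) {ν : ℕ}
    (hker : RingHom.ker (φ : R →+* ℂ) ^ ν = ⊥) (l : R →ₗ[ℂ] ℂ)
    (hl : ∀ r : R, (∀ x, l (x * r) = 0) → r = 0)
    (hshape : Module.finrank ℂ R ≤ 4 ∨
      (∃ (r : ℕ) (e : R), e ^ r = 0 ∧ ∃ b : Module.Basis (Fin r) ℂ R, ∀ j, b j = e ^ (j : ℕ)) ∨
      (∀ a b : R, φ a = 0 → φ b = 0 → a * b = 0) ∨ RingHom.ker (φ : R →+* ℂ) ^ 3 = ⊥)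
    (A : Matrix (Fin n) (Fin n) (MvPolynomial σ R)) (F : MvPolynomial σ ℂ)
    (hA : ∀ a b, (A a b).IsHomogeneous 1) (hF : ∀ d, l (coeff d A.det) = coeff d F)
    (p : σ → ℂ) (hp : eval (fun i => algebraMap ℂ R (p i)) A.det = 0) :
    (hess0 (transl p F)).rank ≤ 2 * Module.finrank ℂ R * n :=
  localHessianBound_of_shallow hn φ hker l hl hshape A F (fun a b => (hA a b).totalDegree_le) hF p hp

end Shallow

/-! ### The rung `(n, ≤ s)` from a good space and input (B) for DEEP pieces only -/

section Deep

/-- **Every point `(n, s)`, `n ≥ 10`, from a good `c`-space (`s < c`, threshold `t ≥ 2sn`) and the local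
Hessian bound for DEEP pieces only** — finite-dimensional local Frobenius `R` with `5 ≤ dim R ≤ s`, NO power
basis, kernel NOT square-zero and `(ker φ)³ ≠ 0`; all other pieces are served by
`localHessianBound_of_shallow_of_isHomogeneous`. [cite: MignonRessayre2004, §2] -/
theorem not_hasAlgDetRepr_perPoly_self_of_deepBound {n s c t : ℕ} (hn : 10 ≤ n)
    (hH : ∀ (R : Type) [CommRing R] [Algebra ℂ R] [Module.Finite ℂ R], Module.finrank ℂ R ≤ s →
      5 ≤ Module.finrank ℂ R →
      ∀ (φ : R →ₐ[ℂ] ℂ) (ν : ℕ), RingHom.ker (φ : R →+* ℂ) ^ ν = ⊥ →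
      ¬ (∃ (r : ℕ) (e : R), e ^ r = 0 ∧ ∃ b : Module.Basis (Fin r) ℂ R, ∀ j, b j = e ^ (j : ℕ)) →
      ¬ (∀ a b : R, φ a = 0 → φ b = 0 → a * b = 0) → RingHom.ker (φ : R →+* ℂ) ^ 3 ≠ ⊥ →
      ∀ (l : R →ₗ[ℂ] ℂ), (∀ r : R, (∀ x, l (x * r) = 0) → r = 0) →
      ∀ (A : Matrix (Fin n) (Fin n) (MvPolynomial (Fin n × Fin n) R)) (F : MvPolynomial (Fin n × Fin n) ℂ),
        (∀ a b, (A a b).IsHomogeneous 1) → (∀ d, l (coeff d A.det) = coeff d F) →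
        ∀ p : Fin n × Fin n → ℂ, eval (fun i => algebraMap ℂ R (p i)) A.det = 0 →
          (hess0 (transl p F)).rank ≤ 2 * Module.finrank ℂ R * n)
    (hW : ∃ w : Fin c → (Fin n × Fin n → ℂ), LinearIndependent ℂ w ∧
      ∀ a : Fin c → ℂ, a ≠ 0 → eval (∑ i, a i • w i) (perPoly (Fin n) ℂ) = 0 →
        t < (hess0 (transl (∑ i, a i • w i) (perPoly (Fin n) ℂ))).rank)
    (hsc : s < c) (ht : 2 * s * n ≤ t) : ¬ HasAlgDetRepr (perPoly (Fin n) ℂ) n s := by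
  refine not_hasAlgDetRepr_perPoly_self_of_localHessianBound_dim (by omega) ?_ hW hsc ht
  intro R _ _ _ hR φ ν hker l hl A F hA hF p hp
  by_cases hshape : Module.finrank ℂ R ≤ 4 ∨
      (∃ (r : ℕ) (e : R), e ^ r = 0 ∧ ∃ b : Module.Basis (Fin r) ℂ R, ∀ j, b j = e ^ (j : ℕ)) ∨
      (∀ a b : R, φ a = 0 → φ b = 0 → a * b = 0) ∨ RingHom.ker (φ : R →+* ℂ) ^ 3 = ⊥
  · exact localHessianBound_of_shallow_of_isHomogeneous hn φ hker l hl hshape A F hA hF p hp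
  · simp only [not_or] at hshape
    obtain ⟨h5, hcurv, hsq, hk3⟩ := hshape
    exact hH R hR (by omega) φ ν hker hcurv hsq hk3 l hl A F hA hF p hp

/-- **All large `n`, every fixed `s`: the rung `(m, s') ≤ (n, s)` from good `(s+1)`-spaces (threshold `2sn`)
and input (B) for DEEP pieces of dimension `≤ s` at large `n` only.** [folklore] -/
theorem corner_all_large_of_deepBound_eventually (s n₁ : ℕ)
    (hH : ∀ n : ℕ, n₁ ≤ n → ∀ (R : Type) [CommRing R] [Algebra ℂ R] [Module.Finite ℂ R],
      Module.finrank ℂ R ≤ s → 5 ≤ Module.finrank ℂ R →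
      ∀ (φ : R →ₐ[ℂ] ℂ) (ν : ℕ), RingHom.ker (φ : R →+* ℂ) ^ ν = ⊥ →
      ¬ (∃ (r : ℕ) (e : R), e ^ r = 0 ∧ ∃ b : Module.Basis (Fin r) ℂ R, ∀ j, b j = e ^ (j : ℕ)) →
      ¬ (∀ a b : R, φ a = 0 → φ b = 0 → a * b = 0) → RingHom.ker (φ : R →+* ℂ) ^ 3 ≠ ⊥ →
      ∀ (l : R →ₗ[ℂ] ℂ), (∀ r : R, (∀ x, l (x * r) = 0) → r = 0) →
      ∀ (A : Matrix (Fin n) (Fin n) (MvPolynomial (Fin n × Fin n) R)) (F : MvPolynomial (Fin n × Fin n) ℂ),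
        (∀ a b, (A a b).IsHomogeneous 1) → (∀ d, l (coeff d A.det) = coeff d F) →
        ∀ p : Fin n × Fin n → ℂ, eval (fun i => algebraMap ℂ R (p i)) A.det = 0 →
          (hess0 (transl p F)).rank ≤ 2 * Module.finrank ℂ R * n)
    (hW : ∃ n₀ : ℕ, ∀ n ≥ n₀, ∃ w : Fin (s + 1) → (Fin n × Fin n → ℂ), LinearIndependent ℂ w ∧
      ∀ a : Fin (s + 1) → ℂ, a ≠ 0 → eval (∑ i, a i • w i) (perPoly (Fin n) ℂ) = 0 →
        2 * s * n < (hess0 (transl (∑ i, a i • w i) (perPoly (Fin n) ℂ))).rank) :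
    ∃ n₀ : ℕ, ∀ n ≥ n₀, ∀ m s' : ℕ, m ≤ n → s' ≤ s → ¬ HasAlgDetRepr (perPoly (Fin n) ℂ) m s' := by
  obtain ⟨n₀, hgood⟩ := hW
  refine ⟨max (max n₀ 10) n₁, fun n hn m s' hm hs' hrep => ?_⟩
  have hn₀ : n₀ ≤ n := le_trans (le_max_left _ _) (le_trans (le_max_left _ _) hn)
  have hn10 : 10 ≤ n := le_trans (le_max_right _ _) (le_trans (le_max_left _ _) hn)
  have hnn₁ : n₁ ≤ n := le_trans (le_max_right _ _) hn
  exact not_hasAlgDetRepr_perPoly_self_of_deepBound hn10 (hH n hnn₁) (hgood n hn₀)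
    (Nat.lt_succ_self s) le_rfl (hrep.mono hm hs')

end Deep

end Summit.ValiantsHypothesis.ValiantsHypothesis.Theorems.GrenetZeonPolySizeQPAlgebra

end
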